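import Literature.AnabelianGeometry.AbsoluteAnabelian.AbsTopII.DehnTwistLoopBranchPair
import Literature.AnabelianGeometry.AbsoluteAnabelian.AbsTopII.DehnTwistFreeGroupInputs
import HarnessLib

/-!
# [AbsTopII] Prop 1.3 (ii) at the NODAL model: UNCONDITIONAL (the two `F̂₂`-inputs discharged)

S. Mochizuki, *Topics in Absolute Anabelian Geometry II* [AbsTopII] (bib `MochizukiAbsTopII2013`; locators =
PDF pages of the kurims manuscript `paper:url-585b8d0ad0d9`), §1, Prop 1.3 (ii) p. 11 ("If `e` is a node …
`1 → Π_e → I_e → I → 1`; `I_e ≅ Ẑ^Σ × Ẑ^Σ`; `I_v × I_{v′} → I_e` open injective with image of index `i^Σ_e`")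
and (iii) p. 11 ("`I_v ⥲ I`").

PROOF-ONLY assembly (no definition), abc-iut-L4-t6 lineage, row «DPSC-NODAL-MODEL», closing stage: the
conditional closers of S3a/S3b (`DehnTwistLoopInertia`, `DehnTwistLoopBranchPair`: hypotheses
`Z_{F̂₂}(b^Ẑ) = b^Ẑ` and `Z_{F̂₂}(Π_v) = 1` BY NAME) composed with abc-iut-f-069's discharge of exactly these
two facts inside `F̂₂` (`DehnTwistFreeGroupInputs`: `centralizer_bAxis_eq` — used verbatim, `nodeGp := bAxis` — from [SemiAnbd] Ex. 2.10
commensurable terminality, `centralizer_vertClosure_eq_bot` from malnormality of `b^Ẑ`).  Net: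

* `prop_1_3_ii'_dpsc_holds` — **the typed `Prop_1_3_ii'` HOLDS at the nodal Dehn-twist datum `dpsc i hi`
  (every `i ≥ 1`), all three clauses, non-idly, with NO hypothesis**; `prop_1_3_ii_dpsc_holds` — the v1
  typing `Prop_1_3_ii` likewise;
* `Iv_sup_PiG_dpsc_holds` — the I-surjectivity input «`I_v · Π_𝔾 = Π_I`» of the abstract closers holds at
  this model unconditionally (`I_v = 1 ⋊ Ẑ`, `Iv_dpsc_eq_range_inr_holds`);
* `exists_nodal_model_prop_1_3_ii` — a DPSC datum WITH A NODE (`Σ` = all primes, `i^Σ_e = i`) satisfying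
  both typings exists: the coverage-table entry "(ii)/(ii′) non-idle at constructed data".
HONEST FRAMING: classical profinite group theory in a constructed model under OUR kernel check (constructed ≠
geometric); typed ≠ proved for the paper's geometric statement; nothing here bears on [IUTchIII] Cor 3.12.
-/

noncomputable section

open scoped Pointwise

namespace Literature.AnabelianGeometry.AbsoluteAnabelian.AbsTopII.DehnTwist

open Literature.AnabelianGeometry.EtaleTheta.SettingModel

/-- `Z_{F̂₂}(Π_v) = 1` for the verticial group `Π_v = ⟨b^Ẑ, ab^Ẑa⁻¹⟩^` of the loop datum (abc-iut-f-069's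
`centralizer_vertClosure_eq_bot`, respelled on `vertGp`). [cite: MochizukiAbsTopII2013, Prop 1.3 (iii) p.11] -/
theorem centralizer_vertGp_eq_bot : Subgroup.centralizer (vertGp : Set F₂hatT) = ⊥ :=
  centralizer_vertClosure_eq_bot

section Dpsc

variable {i : ℕ} (hi : 0 < i)

/-- **`I_v = 1 ⋊ Ẑ` at the nodal model, unconditionally.** [cite: MochizukiAbsTopII2013, Prop 1.3 (iii) p.11] -/
theorem Iv_dpsc_eq_range_inr_holds (v : (dpsc i hi).Vert) :
    (dpsc i hi).Iv v = (SemidirectProduct.inr : ZH →* Ext i).range :=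
  Iv_dpsc_eq_range_inr hi centralizer_vertGp_eq_bot v

/-- **«`I_v · Π_𝔾 = Π_I`» (I-surjectivity, "`I_v ⥲ I`") at the nodal model, unconditionally.**
[cite: MochizukiAbsTopII2013, Prop 1.3 (iii) p.11] -/
theorem Iv_sup_PiG_dpsc_holds (v : (dpsc i hi).Vert) :
    (dpsc i hi).Iv v ⊔ (dpsc i hi).PiG = (dpsc i hi).PiI :=
  Iv_sup_PiG_dpsc hi centralizer_vertGp_eq_bot v

/-- `I_v ∩ Π_𝔾 = 1` at the nodal model, unconditionally. [cite: MochizukiAbsTopII2013, Prop 1.3 (iii) p.11] -/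
theorem Iv_inf_PiG_dpsc_holds (v : (dpsc i hi).Vert) : (dpsc i hi).Iv v ⊓ (dpsc i hi).PiG = ⊥ :=
  Iv_inf_PiG_dpsc hi centralizer_vertGp_eq_bot v

/-- **[AbsTopII] Prop 1.3 (ii) — the typed `Prop_1_3_ii'` — HOLDS at the nodal Dehn-twist datum `dpsc i hi`,
all clauses, non-idly, with no hypothesis.** [cite: MochizukiAbsTopII2013, Prop 1.3 (ii) p.11] -/
theorem prop_1_3_ii'_dpsc_holds :
    Literature.AnabelianGeometry.AbsoluteAnabelian.AbsTopII.DPSCIndexData.Prop_1_3_ii' (dpsc i hi) :=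
  prop_1_3_ii'_dpsc hi centralizer_bAxis_eq centralizer_vertGp_eq_bot

/-- All vertices of the loop datum are equal (one vertex). [cite: MochizukiAbsTopII2013, Ex 1.1 (ii) p.9] -/
theorem dpsc_vert_eq (v w : (dpsc i hi).Vert) : v = w := by
  obtain ⟨⟨⟩⟩ := v
  obtain ⟨⟨⟩⟩ := w
  rfl

/-- The v1 typing `Prop_1_3_ii` HOLDS at the nodal Dehn-twist datum as well (its branch clause drops the
`Π_𝔾`-membership of the conjugators and the guard). [cite: MochizukiAbsTopII2013, Prop 1.3 (ii) p.11] -/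
theorem prop_1_3_ii_dpsc_holds :
    Literature.AnabelianGeometry.AbsoluteAnabelian.AbsTopII.DPSCIndexData.Prop_1_3_ii (dpsc i hi) := by
  intro e
  obtain ⟨h1, h2, h3⟩ := prop_1_3_ii'_dpsc_holds hi e
  refine ⟨h1, h2, fun v v' hv hv' => ?_⟩
  obtain ⟨γ, γ', -, -, J, hJ⟩ := h3 v v' hv hv' (Or.inr fun w _ => dpsc_vert_eq hi w v)
  exact ⟨γ, γ', J, hJ⟩

end Dpsc

/-- **A DPSC datum WITH A NODE at which Prop 1.3 (ii) holds non-idly EXISTS** (`Σ` = all primes, the node's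
`Σ`-index any prescribed `i ≥ 1`), in both typings. [cite: MochizukiAbsTopII2013, Prop 1.3 (ii) p.11] -/
theorem exists_nodal_model_prop_1_3_ii (i : ℕ) (hi : 0 < i) :
    ∃ X : DPSCIndexData.{0}, Nonempty X.Node ∧ X.Sigma = {p | p.Prime} ∧ (∀ e : X.Node, X.sigmaIndex e = i) ∧
      Literature.AnabelianGeometry.AbsoluteAnabelian.AbsTopII.DPSCIndexData.Prop_1_3_ii' X ∧
      Literature.AnabelianGeometry.AbsoluteAnabelian.AbsTopII.DPSCIndexData.Prop_1_3_ii X :=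
  ⟨dpsc i hi, dpsc_node_nonempty i hi, rfl, fun _ => rfl, prop_1_3_ii'_dpsc_holds hi,
    prop_1_3_ii_dpsc_holds hi⟩

/-! ### Prop 1.3 (iii), first clause "`I_v ⥲ I`", at the nodal model (appended) -/

/-- **[AbsTopII] Prop 1.3 (iii), first clause — the typed `DPSCData.Prop13iii` ("`I_v ⥲ I`": `I_v ∩ Π_𝔾 = 1`
and `I_v · Π_𝔾 = Π_I` for every vertex) — HOLDS at the nodal Dehn-twist datum `dpsc i hi`, with no
hypothesis** (a NON-IDLE instance: `I = Ẑ ≠ 1` here, realised by the twist section `1 ⋊ Ẑ`).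
[cite: MochizukiAbsTopII2013, Prop 1.3 (iii) p.11] -/
theorem prop13iii_dpsc_holds {i : ℕ} (hi : 0 < i) : (dpsc i hi).toDPSCData.Prop13iii :=
  fun v => ⟨Iv_inf_PiG_dpsc_holds hi v, Iv_sup_PiG_dpsc_holds hi v⟩

/-- A DPSC datum WITH A NODE (and non-trivial inertia quotient `I = Ẑ`) at which Prop 1.3 (ii) (both typings)
and the first clause of (iii) hold EXISTS. [cite: MochizukiAbsTopII2013, Prop 1.3 (iii) p.11] -/
theorem exists_nodal_model_prop_1_3_ii_iii (i : ℕ) (hi : 0 < i) :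
    ∃ X : DPSCIndexData.{0}, Nonempty X.Node ∧ X.Sigma = {p | p.Prime} ∧ (∀ e : X.Node, X.sigmaIndex e = i) ∧
      Literature.AnabelianGeometry.AbsoluteAnabelian.AbsTopII.DPSCIndexData.Prop_1_3_ii' X ∧
      Literature.AnabelianGeometry.AbsoluteAnabelian.AbsTopII.DPSCIndexData.Prop_1_3_ii X ∧
      X.toDPSCData.Prop13iii :=
  ⟨dpsc i hi, dpsc_node_nonempty i hi, rfl, fun _ => rfl, prop_1_3_ii'_dpsc_holds hi,
    prop_1_3_ii_dpsc_holds hi, prop13iii_dpsc_holds hi⟩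

end Literature.AnabelianGeometry.AbsoluteAnabelian.AbsTopII.DehnTwist

end
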